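import Literature.MathematicalPhysics.QuantumFieldTheory.CurvatureGaussianField
import Literature.Probability.LatticeModels.LatticeGreenAsymptotics
import HarnessLib

/-!
# Stub `stub_kernelDecay` of line `Sketch` (crux `stmt-QuantumFields-8760`)

Route `EquipartitionCriticality` of `YangMills`, crux item `stmt-QuantumFields-8760`
(`Summit.QuantumFields.YangMills.Theses.EquipartitionCriticality.EquipartitionPinsProbe`), line
`Sketch`, STUB "kernel decay" of the lead's skeleton.

What is proved: the two-plaquette kernel `T(p, q) = curvatureTwoPoint p q` of the lattice Maxwell
(curvature) Gaussian field on `ℤ⁴` decays in its second slot: for all plaquettes `p, q`,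
`v ↦ T(p, (x_q + v; q))` tends to `0` along the cofinite filter of `ℤ⁴`.

Proof: `T(p, (x_q + v; q)) = ∑_{a,b} σₐ σ_b · edgeGreen (∂ₐ p) (∂_b q + v)`
(`KernelDecay.plaquetteBoundary_shift`) is a sum of sixteen terms each of which is either
identically `0` (different edge directions) or `σₐ σ_b · latticeGreen (c - v) / 2` with a constant
offset `c` (`edgeGreen_apply`). The lattice Green function of `ℤ^d`, `d ≥ 3`, tends to `0` at
infinity (`KernelDecay.tendsto_latticeGreen_cofinite`): by the tree's
`latticeGreen_asymptotics`, `|latticeGreen x| ≤ |a_d| |x|^{2-d} + K |x|^{-d}` for `x ≠ 0`, and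
`|x| = √(Σᵢ xᵢ²) → ∞` along the cofinite filter because sub-level sets of `Σᵢ xᵢ²` lie in finite
boxes (`KernelDecay.finite_setOf_sum_sq_lt`); `v ↦ c - v` is injective, so it maps the cofinite
filter to itself.
-/

noncomputable section

open Filter
open scoped Topology Real

open Literature.MathematicalPhysics.QuantumFieldTheory Literature.MathematicalPhysics.QuantumLattice
  Literature.Probability.LatticeModels

namespace Summit.QuantumFields.YangMills.Theorems.EquipartitionPinsProbe

namespace KernelDecay

variable {d : ℕ}

/-- A sub-level set `{x ∈ ℤ^d | Σᵢ xᵢ² < R}` of the squared Euclidean norm is finite: it lies in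
the box `[-N, N]^d` for any natural number `N ≥ R`. -/
theorem finite_setOf_sum_sq_lt (R : ℝ) :
    {x : Site d | ∑ i, ((x i : ℤ) : ℝ) ^ 2 < R}.Finite := by
  obtain ⟨N, hN⟩ := exists_nat_ge R
  refine (Set.Finite.pi (t := fun _ : Fin d => Set.Icc (-(N : ℤ)) N)
    fun _ => Set.finite_Icc _ _).subset ?_
  intro x hx
  simp only [Set.mem_setOf_eq] at hx
  simp only [Set.mem_pi, Set.mem_univ, true_implies, Set.mem_Icc]
  intro i
  have h1 : ((x i : ℤ) : ℝ) ^ 2 ≤ ∑ j, ((x j : ℤ) : ℝ) ^ 2 :=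
    Finset.single_le_sum (f := fun j => ((x j : ℤ) : ℝ) ^ 2) (fun j _ => sq_nonneg _)
      (Finset.mem_univ i)
  have h2 : ((x i : ℤ) : ℝ) ^ 2 < N := by linarith
  have h3 : (x i) ^ 2 < N := by exact_mod_cast h2
  have ha : x i ≤ (x i) ^ 2 := Int.le_self_sq (x i)
  have hb : -(x i) ≤ (x i) ^ 2 := by
    have := Int.le_self_sq (-(x i))
    rwa [neg_sq] at this
  constructor <;> linarith

/-- The squared Euclidean norm `Σᵢ xᵢ²` tends to `+∞` along the cofinite filter of `ℤ^d`. -/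
theorem tendsto_sum_sq_cofinite_atTop :
    Tendsto (fun x : Site d => ∑ i, ((x i : ℤ) : ℝ) ^ 2) cofinite atTop := by
  refine tendsto_atTop.2 fun R => ?_
  simp only [Filter.eventually_cofinite, not_le]
  exact finite_setOf_sum_sq_lt R

/-- The Euclidean norm `|x| = √(Σᵢ xᵢ²)` tends to `+∞` along the cofinite filter of `ℤ^d`. -/
theorem tendsto_sqrt_sum_sq_cofinite_atTop :
    Tendsto (fun x : Site d => Real.sqrt (∑ i, ((x i : ℤ) : ℝ) ^ 2)) cofinite atTop :=
  Real.tendsto_sqrt_atTop.comp tendsto_sum_sq_cofinite_atTop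

/-- **Decay of the lattice Green function** (`d ≥ 3`): `latticeGreen x → 0` as `x → ∞` in `ℤ^d`
(along the cofinite filter), from the asymptotics
`|latticeGreen x - a |x|^{2-d}| ≤ K |x|^{-d}` (tree `latticeGreen_asymptotics`). -/
theorem tendsto_latticeGreen_cofinite (hd : 3 ≤ d) :
    Tendsto (latticeGreen : Site d → ℝ) cofinite (𝓝 0) := by
  obtain ⟨K, hK⟩ := latticeGreen_asymptotics hd
  set A : ℝ := Real.Gamma ((d : ℝ) / 2 - 1) / (2 * π ^ ((d : ℝ) / 2))
  have hd' : (3 : ℝ) ≤ d := by exact_mod_cast hd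
  have h1 : Tendsto (fun x : Site d => Real.sqrt (∑ i, ((x i : ℤ) : ℝ) ^ 2) ^ (2 - (d : ℝ)))
      cofinite (𝓝 0) := by
    have := (tendsto_rpow_neg_atTop (y := (d : ℝ) - 2) (by linarith)).comp
      (tendsto_sqrt_sum_sq_cofinite_atTop (d := d))
    refine this.congr fun x => ?_
    simp only [Function.comp_apply, neg_sub]
  have h2 : Tendsto (fun x : Site d => Real.sqrt (∑ i, ((x i : ℤ) : ℝ) ^ 2) ^ (-(d : ℝ)))
      cofinite (𝓝 0) :=
    (tendsto_rpow_neg_atTop (y := (d : ℝ)) (by linarith)).comp tendsto_sqrt_sum_sq_cofinite_atTop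
  have hbound : ∀ᶠ x : Site d in cofinite,
      ‖latticeGreen x‖ ≤ |A| * Real.sqrt (∑ i, ((x i : ℤ) : ℝ) ^ 2) ^ (2 - (d : ℝ)) +
        |K| * Real.sqrt (∑ i, ((x i : ℤ) : ℝ) ^ 2) ^ (-(d : ℝ)) := by
    filter_upwards [eventually_cofinite_ne (0 : Site d)] with x hx
    have hKx := hK x hx
    set r : ℝ := Real.sqrt (∑ i, ((x i : ℤ) : ℝ) ^ 2) with hr
    have hr0 : 0 ≤ r := Real.sqrt_nonneg _
    have hp1 : 0 ≤ r ^ (2 - (d : ℝ)) := Real.rpow_nonneg hr0 _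
    have hp2 : 0 ≤ r ^ (-(d : ℝ)) := Real.rpow_nonneg hr0 _
    rw [Real.norm_eq_abs]
    calc |latticeGreen x|
        = |(latticeGreen x - A * r ^ (2 - (d : ℝ))) + A * r ^ (2 - (d : ℝ))| := by
          rw [sub_add_cancel]
      _ ≤ |latticeGreen x - A * r ^ (2 - (d : ℝ))| + |A * r ^ (2 - (d : ℝ))| := abs_add_le _ _
      _ ≤ K * r ^ (-(d : ℝ)) + |A| * r ^ (2 - (d : ℝ)) := by
          exact add_le_add hKx (by rw [abs_mul, abs_of_nonneg hp1])
      _ ≤ |A| * r ^ (2 - (d : ℝ)) + |K| * r ^ (-(d : ℝ)) := by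
          nlinarith [le_abs_self K]
  refine squeeze_zero_norm' hbound ?_
  simpa using (h1.const_mul |A|).add (h2.const_mul |K|)

/-- Shifted decay: for every `c ∈ ℤ^d` (`d ≥ 3`), `latticeGreen (c - v) → 0` as `v → ∞` along the
cofinite filter (`v ↦ c - v` is injective, hence cofinite-to-cofinite). -/
theorem tendsto_latticeGreen_sub_cofinite (hd : 3 ≤ d) (c : Site d) :
    Tendsto (fun v : Site d => latticeGreen (c - v)) cofinite (𝓝 0) :=
  (tendsto_latticeGreen_cofinite hd).comp
    (sub_right_injective : Function.Injective fun v : Site d => c - v).tendsto_cofinite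

/-- Decay of the edge Green kernel in its second slot: for edges `e, f` of `ℤ^d` (`d ≥ 3`),
`edgeGreen e (x_f + v, dir f) → 0` as `v → ∞` along the cofinite filter. -/
theorem tendsto_edgeGreen_shift (hd : 3 ≤ d) (e f : ZdEdge d) :
    Tendsto (fun v : Site d => edgeGreen e (f.1 + v, f.2)) cofinite (𝓝 0) := by
  by_cases h : e.2 = f.2
  · simp only [edgeGreen_apply, h, if_true]
    have := (tendsto_latticeGreen_sub_cofinite hd (e.1 - f.1)).div_const 2
    rw [zero_div] at this
    refine this.congr fun v => ?_
    rw [sub_sub]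
  · simp only [edgeGreen_apply, h, if_false]
    exact tendsto_const_nhds

/-- Translating a plaquette translates its boundary edges:
`∂_b (x_q + v; q) = (x_{∂_b q} + v, dir (∂_b q))`. -/
theorem plaquetteBoundary_shift (q : ZdPlaquette d) (v : Site d) (b : Fin 4) :
    plaquetteBoundary (q.1 + v, q.2) b =
      ((plaquetteBoundary q b).1 + v, (plaquetteBoundary q b).2) := by
  fin_cases b <;> simp [plaquetteBoundary, add_right_comm _ v]

/-- Decay of the two-plaquette kernel in its second slot, in every dimension `d ≥ 3`:
`curvatureTwoPoint p (x_q + v; q) → 0` as `v → ∞` along the cofinite filter of `ℤ^d`. -/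
theorem tendsto_curvatureTwoPoint_shift (hd : 3 ≤ d) (p q : ZdPlaquette d) :
    Tendsto (fun v : Site d => curvatureTwoPoint p (q.1 + v, q.2)) cofinite (𝓝 0) := by
  have h : ∀ a b : Fin 4, Tendsto (fun v : Site d =>
      plaquetteBoundarySign a * plaquetteBoundarySign b *
        edgeGreen (plaquetteBoundary p a) (plaquetteBoundary (q.1 + v, q.2) b)) cofinite (𝓝 0) := by
    intro a b
    have := (tendsto_edgeGreen_shift hd (plaquetteBoundary p a) (plaquetteBoundary q b)).const_mul
      (plaquetteBoundarySign a * plaquetteBoundarySign b)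
    rw [mul_zero] at this
    refine this.congr fun v => ?_
    rw [plaquetteBoundary_shift]
  have hsum := tendsto_finsetSum Finset.univ
    fun a _ => tendsto_finsetSum Finset.univ fun b _ => h a b
  simpa [curvatureTwoPoint] using hsum

end KernelDecay

/-- STUB "kernel decay" — **the curvature kernel decays in its second slot**: for all plaquettes
`p, q` of `ℤ⁴`, `curvatureTwoPoint p (x_q + v; q) → 0` as `v → ∞` (cofinite filter on `ℤ⁴`);
the kernel is a signed sum of sixteen shifted edge Green functions `[dirs equal] G₀(c - v)`, and
`G₀ = latticeGreen / 2 → 0` at infinity in `d = 4 ≥ 3` (`latticeGreen_asymptotics`). -/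
theorem stub_kernelDecay :
    ∀ (p q : Literature.MathematicalPhysics.QuantumLattice.ZdPlaquette 4),
      Filter.Tendsto (fun v : Literature.Probability.LatticeModels.Site 4 =>
          Literature.MathematicalPhysics.QuantumFieldTheory.curvatureTwoPoint p (q.1 + v, q.2))
        Filter.cofinite (nhds 0) :=
  fun p q => KernelDecay.tendsto_curvatureTwoPoint_shift (by norm_num) p q

end Summit.QuantumFields.YangMills.Theorems.EquipartitionPinsProbe

end
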